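import Literature.Geometry.Kaehler.ComplexTorusIntegralHodgeLatticeThetaDegreesFourierDuality
import Literature.Geometry.Kaehler.ComplexTorusFourierPontryagin
import Literature.Geometry.Kaehler.ComplexTorusLefschetzDualPontryaginAnyBasis
import HarnessLib

/-!
# The Fourier transform intertwines the Lefschetz `sl₂` of `(X, θ)` with that of the dual polarised torus `(X̂, θ_δ)`:
# `F(θ ∪ x) = −d₁d_g·Λ_{E_δ}(F x)`, `F(Λ_ω x) = E^* ∧ F(x)`, `F(ker L_θ) = P•(X̂, E_δ)` — every lattice basis

[cite: Polishchuk2007FourierStable, §1 (p. 3, the display after (1.1): "`F_d e F_d⁻¹ = −f`, `F_d f F_d⁻¹ = −e`, `F_d h F_d⁻¹ = −h`", after [K] = Künnemann 1993)]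
[cite: Lange2023AbelianVarietiesComplex, §6.2.3 Prop. 6.2.18 (p. 308); §6.3.2 Thm. 6.3.5 with (6.12), Thm. 6.3.6 (pp. 315–316); §2.5.1 Prop. 2.5.1 (p. 131)]
[cite: Beauville1983FourierChow, Prop. 3 (ii) (p. 243); §3 Prop. 5 (p. 248)]
[cite: Voisin2002, §6.2.1 Lemma 6.19; §6.2.2 Lemma 6.24]

Row g50-#4 of the `lit-hodgefound` p09 lineage (the Fourier transform on the cohomology of a polarised complex torus, rows
g50-#1 – g50-#3). SETTING: `X = E/Φ(ℤ^ι)` a complex torus with a Riemann form `η = θ = E` of type `(d₁, …, d_g)` on its lattice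
(`IsRiemannForm Φ η`, `IsPolarizationType Φ η d`, `d : Fin (j + 2) → ℕ`, `g = j + 2`; NO symplectic presentation of the lattice
is assumed), `X̂ = Ω̄/Λ̂` the dual torus (`dualPeriod Φ`), `E^*` Lang's transport of `E` to `X̂` (`dualForm`), `E_δ = d₁d_g·E^*` the
DUAL POLARISATION of `X̂`, a Riemann form of type `δ̂ᵢ = d₁d_g/d_{g+1−i}` (`IsPolarizationType.dual`, `IsRiemannForm.dualPolarization`,
Prop. 2.5.1), `F = fourierForms Φ e : Hᵖ(X, ℚ) → H^{2g−p}(X̂, ℚ)` the cohomological Fourier(–Mukai) transform (Prop. 6.2.20),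
`⋆ = μ_*(pr₁^* · ∪ pr₂^* ·)` the Pontryagin product on lattice frames `E₂` (of `Λ ⊕ Λ`) and `e` (of `Λ`), `Λ_η : H^{m+2} → Hᵐ` Voisin's
dual Lefschetz operator (`lefschetzDual η m`, Lemma 6.19), `c_L = c₁(L)^{∧(g−1)}/(d (g−1)!)` Lange's curve class (`IsNSForm.curveClass`,
`d = d₁⋯d_g`), `Pᵏ(X̂, E_δ) = primitiveForms E_δ k` the `E_δ`-primitive classes.

Polishchuk (after Künnemann) records that the Fourier transform intertwines the Lefschetz `sl₂`-triple `(e, f, h)` of a polarisation,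
`e(x) = d·x`, `f(x) = (d^{g−1}/((g−1)! χ(d))) ∗ x`: "`F_d e F_d⁻¹ = −f`, `F_d f F_d⁻¹ = −e`, `F_d h F_d⁻¹ = −h`" (his `F_d = χ(d)⁻¹ φ_d^* ∘ F`
transports back to `X`; here we stay on `X̂`, where `φ_L^* E_δ`-bookkeeping becomes the factor `d₁d_g` of `E_δ = d₁d_g·E^*`). The tree
had the `f`-half in a symplectic lattice basis (`IsSymplecticEnum.fourierForm_lefschetzDual_neg`, `F(Λ_ω x) = E^* ∧ F(x)`) and the
identification `Λ_η = −ε·(c_L ⋆ ·)` for every lattice basis (`IsPolarizationType.coe_lefschetzDual_eq_neg_sign_smul_pontryaginForms_curveClass`).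
THIS FILE proves, for EVERY polarised complex torus and EVERY lattice basis:

* §1 `IsPolarizationType.prod_dualType_mul_prod_eq_pow` (`δ̂₁⋯δ̂_g · d₁⋯d_g = (d₁d_g)^g`) and
  **`IsPolarizationType.fourierForms_ratClass_eq_smul_dualCurveClass`: `F[θ] = (−1)^g·d₁d_g · c_{L_δ}`** in `H^{2g−2}(X̂, ℚ)` — the
  Fourier transform of the polarisation class is the printed multiple of the CURVE CLASS OF THE DUAL POLARISATION (Beauville's
  `(g−1)!·F(θ) = −d·(E^*)^{∧(g−1)}`, Thm. 6.3.5/(6.12), rewritten through `E_δ = d₁d_g E^*` and the dual type).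
* §2 **`IsPolarizationType.coe_fourierForms_cupProduct_ratClass`: `F(θ ∪ x) = −d₁d_g · Λ_{E_δ}(F x)`** for every `x ∈ Hᵇ(X, ℚ)` and all
  frames — the `e`-half "`F e F⁻¹ = −f`": Prop. 6.2.18 (b) `F(θ ∪ x) = ±F(θ) ⋆ F(x)`, §1, and `Λ_{E_δ} = −ε̂·(c_{L_δ} ⋆ ·)` on `X̂`
  (the orientation characters and `(−1)^g` cancel).
* §3 `IsPolarizationType.fourierForm_pontryaginForms_curveClass` (`F(c_L ⋆ y) = ±E^* ∧ F(y)`),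
  **`IsPolarizationType.fourierForm_lefschetzDual_neg`: `F(Λ_ω x) = E^* ∧ F(x)`** (`ω = c₁(L) = −E`) and
  `IsPolarizationType.fourierForm_lefschetzDual` (`F(Λ_η x) = −E^* ∧ F(x)`) — the `f`-half "`F f F⁻¹ = −e`" WITHOUT a symplectic
  presentation (generalising the `IsSymplecticEnum` rows of `ComplexTorusPoincareFormulaPontryagin` / `ComplexTorusLefschetzDualPontryagin` §7).
* §4 **`IsPolarizationType.cupProduct_ratClass_eq_zero_iff_fourierForms_mem_primitiveForms`: `θ ∪ x = 0 ↔ F x ∈ P^{m+2}(X̂, E_δ)`**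
  (`m + 2 ≤ g`; `F` is injective and `P = ker Λ`, Lemma 6.24) — the Fourier transform carries the kernel of the Lefschetz operator
  `L_θ` of `X` onto the `E_δ`-primitive cohomology of `X̂` — and `IsPolarizationType.lefschetzDual_eq_zero_iff_dualForm_wedge_fourierForm`
  (`Λ_η x = 0 ↔ E^* ∧ F x = 0`).

## References

* [cite: Polishchuk2007FourierStable, §1 (p. 3)]
* [cite: Lange2023AbelianVarietiesComplex, §6.2.3 Prop. 6.2.18 (p. 308); §6.2.4 Prop. 6.2.20 (p. 310); §6.3.2 Thm. 6.3.5 with (6.12), Thm. 6.3.6 (pp. 315–316); §2.5.1 Prop. 2.5.1 (p. 131)]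
* [cite: Beauville1983FourierChow, Prop. 3 (ii) (p. 243); §3 Prop. 5 (p. 248)]
* [cite: Voisin2002, §6.2.1 Lemma 6.19; §6.2.2 Lemma 6.24]
* [cite: Lang1982AbelianFunctions, Ch. VII §5 Thm. 5.2 (pp. 119–120)]
-/

noncomputable section

-- `Module ℂ` / `SMulZeroClass ℂ` synthesis on `E [⋀^Fin k]→L[ℝ] ℂ` (as in `ComplexTorusLefschetzDecomposition`)
set_option maxSynthPendingDepth 3

open Module Function Complex
open LinearMap (BilinForm)
open Literature.LinearAlgebra.Alternating

namespace Literature.Geometry.Kaehler.ComplexTorus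

universe uE

/-! ## §0 Helpers -/

section Generic

/-- `θ^{∧1} = θ`. [folklore] -/
private theorem wedgePow_one_eq_self₁₀₆ {W : Type*} [NormedAddCommGroup W] [NormedSpace ℂ W]
    (θ : W [⋀^Fin 2]→L[ℝ] ℂ) : wedgePow θ 1 = θ := by
  rw [wedgePow_one, Literature.Analysis.Complex.oneForm₀, ContinuousAlternatingMap.constOfIsEmpty_one_wedge]
  ext v
  rfl

/-- `(−1)^m·(−1)^m = 1`. [folklore] -/
private theorem neg_one_pow_mul_self₁₀₆ (m : ℕ) : ((-1 : ℂ) ^ m) * (-1) ^ m = 1 := by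
  rw [← pow_add, ← two_mul, pow_mul, neg_one_sq, one_pow]

end Generic

/-! ## §1 `F[θ] = (−1)^g·d₁d_g·c_{L_δ}` -/

section Arithmetic

variable {ι : Type*} {E : Type uE} [NormedAddCommGroup E] [NormedSpace ℂ E] {Φ : (ι → ℝ) ≃L[ℝ] E} {j : ℕ}
  {η : E [⋀^Fin 2]→L[ℝ] ℝ} {d : Fin (j + 2) → ℕ}

/-- **`δ̂₁⋯δ̂_g · d₁⋯d_g = (d₁d_g)^g`** for the dual type `δ̂ᵢ = d₁d_g/d_{g+1−i}` of a type `(d₁, …, d_g)` (each `dᵢ ∣ d_g ∣ d₁d_g`, so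
`δ̂ᵢ·d_{g+1−i} = d₁d_g`). [cite: Lange2023AbelianVarietiesComplex, §2.5.1 Prop. 2.5.1 (p. 131)] -/
theorem IsPolarizationType.prod_dualType_mul_prod_eq_pow (hd : IsPolarizationType Φ η d) :
    (∏ i : Fin (j + 1 + 1), d 0 * d (Fin.last (j + 1)) / d (Fin.rev i)) * ∏ i, d i = (d 0 * d (Fin.last (j + 1))) ^ (j + 2) := by
  rw [Fintype.prod_equiv Fin.revPerm (fun i ↦ d 0 * d (Fin.last (j + 1)) / d (Fin.rev i))
      (fun i ↦ d 0 * d (Fin.last (j + 1)) / d i) (fun _ ↦ rfl), ← Finset.prod_mul_distrib]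
  have hterm : ∀ i, d 0 * d (Fin.last (j + 1)) / d i * d i = d 0 * d (Fin.last (j + 1)) := fun i ↦
    Nat.div_mul_cancel ((hd.dvd (Fin.le_last _)).mul_left _)
  simp_rw [hterm]
  rw [Finset.prod_const, Finset.card_univ, Fintype.card_fin]

end Arithmetic

section DivisorClass

variable {ι : Type*} [Fintype ι] [LinearOrder ι] {E : Type uE} [NormedAddCommGroup E] [NormedSpace ℂ E]
  (Φ : (ι → ℝ) ≃L[ℝ] E) {j : ℕ} {η : E [⋀^Fin 2]→L[ℝ] ℝ} {d : Fin (j + 2) → ℕ}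

/-- `E_δ^{∧l} = (d₁d_g)^l·(E^*)^{∧l}` for the dual polarisation `E_δ = d₁d_g·E^*`. [cite: Lange2023AbelianVarietiesComplex, §2.5.1 Prop. 2.5.1 (p. 131)] -/
private theorem wedgePow_ofRealForm_dualPolarization₁₀₆ (hη : IsRiemannForm Φ η) (d : Fin (j + 2) → ℕ) (l : ℕ) :
    wedgePow (ofRealForm (((d 0 * d (Fin.last (j + 1)) : ℕ) : ℝ) • dualForm Φ hη.1 hη.nondegenerate)) l =
      ((d 0 * d (Fin.last (j + 1)) : ℕ) : ℂ) ^ l • wedgePow (ofRealForm (dualForm Φ hη.1 hη.nondegenerate)) l := by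
  rw [ofRealForm_smul, wedgePow_smul, Complex.ofReal_natCast]

/-- **`F[θ] = (−1)^g·d₁d_g·c_{L_δ}`: THE FOURIER TRANSFORM OF THE POLARISATION CLASS IS THE CURVE CLASS OF THE DUAL POLARISATION**
(up to the printed constant). For `θ = [E] ∈ H²(X, ℤ)` of type `(d₁, …, d_g)` and every enumeration `e` of a lattice basis,
`F_e[θ] = ((−1)^g d₁d_g) · c_{L_δ}` in `H^{2g−2}(X̂, ℚ)`, where `c_{L_δ} = c₁(L_δ)^{∧(g−1)}/(δ̂ (g−1)!)` is Lange's curve class of the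
dual polarisation `E_δ = d₁d_g·E^*` of type `δ̂` (`δ̂ = δ̂₁⋯δ̂_g`). From Beauville's `(g−1)!·F(θ) = −(d₁⋯d_g)·(E^*)^{∧(g−1)}`
(Thm. 6.3.5 / (6.12) in degree `2`), `c₁(L_δ) = −E_δ`, `E_δ^{∧(g−1)} = (d₁d_g)^{g−1}(E^*)^{∧(g−1)}` and `δ̂·d₁⋯d_g = (d₁d_g)^g`.
[cite: Lange2023AbelianVarietiesComplex, §6.3.2 Thm. 6.3.5 with (6.12) (pp. 315–316); §2.5.1 Prop. 2.5.1 (p. 131)]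
[cite: Beauville1983FourierChow, §3 Prop. 5 (p. 248)] -/
theorem IsPolarizationType.fourierForms_ratClass_eq_smul_dualCurveClass (hd : IsPolarizationType Φ η d)
    (hη : IsRiemannForm Φ η) (e : Fin (2 + 2 * (j + 1)) ≃ ι) :
    fourierForms Φ e (hη.isNSForm.ratClass Φ) =
      ((-1 : ℚ) ^ j * ((d 0 * d (Fin.last (j + 1)) : ℕ) : ℚ)) •
        (hη.dualPolarization Φ hd).isNSForm.curveClass (dualPeriod Φ)
          (∏ i : Fin (j + 1 + 1), d 0 * d (Fin.last (j + 1)) / d (Fin.rev i)) (j + 1) := by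
  have hpos : ∀ i, 0 < d i := fun i ↦ hd.pos hη i
  have hf : ((j + 1).factorial : ℂ) ≠ 0 := by exact_mod_cast (Nat.factorial_pos _).ne'
  have hD : (((d 0 * d (Fin.last (j + 1)) : ℕ) : ℂ)) ≠ 0 := by
    exact_mod_cast (Nat.mul_pos (hpos _) (hpos _)).ne'
  -- `δ̂·d₁⋯d_g = (d₁d_g)^g`, read in `ℂ`
  have hprod : (((∏ i : Fin (j + 1 + 1), d 0 * d (Fin.last (j + 1)) / d (Fin.rev i) : ℕ) : ℂ)) * ∏ i, (d i : ℂ) =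
      (((d 0 * d (Fin.last (j + 1)) : ℕ) : ℂ)) ^ (j + 2) := by
    rw [← Nat.cast_prod]
    exact_mod_cast hd.prod_dualType_mul_prod_eq_pow
  have hQ : (((∏ i : Fin (j + 1 + 1), d 0 * d (Fin.last (j + 1)) / d (Fin.rev i) : ℕ) : ℂ)) ≠ 0 := by
    refine fun h0 ↦ pow_ne_zero (j + 2) hD ?_
    rw [← hprod, h0, zero_mul]
  have hsgn : ((-1 : ℂ) ^ j) * (-1) ^ (j + 1) = -1 := by
    rw [pow_succ, ← mul_assoc, neg_one_pow_mul_self₁₀₆, one_mul]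
  -- Beauville in degree `2 = 2·1`: `(g−1)!·F(θ) = −(d₁⋯d_g)·(E^*)^{∧(g−1)}`
  have hB := hd.factorial_smul_fourierForm_wedgePow Φ hη (show (j + 1) + 1 = j + 2 from rfl) e
    (show 2 * 1 + 2 * (j + 1) = 2 + 2 * (j + 1) by omega)
  rw [wedgePow_one_eq_self₁₀₆, pow_one, Nat.factorial_one, Nat.cast_one] at hB
  simp only [mul_one] at hB
  have hB' : ((j + 1).factorial : ℂ) • fourierForm Φ e rfl (ofRealForm η) =
      (-1 * ∏ i, (d i : ℂ)) • wedgePow (ofRealForm (dualForm Φ hη.1 hη.nondegenerate)) (j + 1) := hB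
  apply Subtype.ext
  rw [coe_fourierForms_apply, IsNSForm.coe_ratClass, Submodule.coe_smul, ← Rat.cast_smul_eq_qsmul ℂ,
    IsNSForm.coe_curveClass, wedgePow_neg, wedgePow_ofRealForm_dualPolarization₁₀₆ Φ hη d (j + 1), smul_smul,
    smul_smul, smul_smul, ← inv_smul_smul₀ hf (fourierForm Φ e rfl (ofRealForm η)), hB', smul_smul]
  congr 1
  rw [Rat.cast_mul, Rat.cast_pow, Rat.cast_neg, Rat.cast_one, Rat.cast_natCast]
  refine mul_right_cancel₀ (mul_ne_zero hQ hf) ?_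
  calc _ = -((((∏ i : Fin (j + 1 + 1), d 0 * d (Fin.last (j + 1)) / d (Fin.rev i) : ℕ) : ℂ)) * ∏ i, (d i : ℂ)) *
        ((((j + 1).factorial : ℂ))⁻¹ * ((j + 1).factorial : ℂ)) := by ring
    _ = -((((d 0 * d (Fin.last (j + 1)) : ℕ) : ℂ)) ^ (j + 2)) := by rw [hprod, inv_mul_cancel₀ hf, mul_one]
    _ = ((-1 : ℂ) ^ j * (((d 0 * d (Fin.last (j + 1)) : ℕ) : ℂ)) * (-1) ^ (j + 1) *
          (((d 0 * d (Fin.last (j + 1)) : ℕ) : ℂ)) ^ (j + 1)) *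
        (((((∏ i : Fin (j + 1 + 1), d 0 * d (Fin.last (j + 1)) / d (Fin.rev i) : ℕ) : ℂ)) *
            ((j + 1).factorial : ℂ))⁻¹ *
          ((((∏ i : Fin (j + 1 + 1), d 0 * d (Fin.last (j + 1)) / d (Fin.rev i) : ℕ) : ℂ)) *
            ((j + 1).factorial : ℂ))) := by
      rw [inv_mul_cancel₀ (mul_ne_zero hQ hf), mul_one]
      linear_combination (-((((d 0 * d (Fin.last (j + 1)) : ℕ) : ℂ)) ^ (j + 2))) * hsgn
    _ = _ := by ring

end DivisorClass

/-! ## §2 `F(θ ∪ x) = −d₁d_g·Λ_{E_δ}(F x)` — "`F e F⁻¹ = −f`" -/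

section LefschetzE

variable {ι : Type*} [Fintype ι] [LinearOrder ι] {E : Type uE} [NormedAddCommGroup E] [NormedSpace ℂ E]
  [FiniteDimensional ℂ (E →L⋆[ℂ] ℂ)] (Φ : (ι → ℝ) ≃L[ℝ] E) {j : ℕ} {η : E [⋀^Fin 2]→L[ℝ] ℝ} {d : Fin (j + 2) → ℕ}

/-- **`F(θ ∪ x) = −d₁d_g·Λ_{E_δ}(F x)` — THE FOURIER TRANSFORM INTERTWINES THE LEFSCHETZ OPERATOR `L_θ` OF `X` WITH THE DUAL
LEFSCHETZ OPERATOR `Λ_{E_δ}` OF THE DUAL POLARISED TORUS `(X̂, E_δ)`**, for every Riemann form `θ = E` of type `(d₁, …, d_g)`, every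
`x ∈ Hᵇ(X, ℚ)`, every lattice basis and all frames (`eₐ`, `e_b`, `e_F` of `Λ` for the three Fourier transforms; `Ê₂`, `ê` of
`Λ̂ ⊕ Λ̂`, `Λ̂` for the Pontryagin product of `X̂`, whose orientation characters cancel against those of `Λ_{E_δ} = −ε̂·(c_{L_δ} ⋆ ·)`):
Polishchuk's "`F_d e F_d⁻¹ = −f`" (after Künnemann), `e = θ ∪ ·`, `f = c_{L} ∗ ·`, read on `X̂` through Prop. 6.2.18 (b)
(`F(θ ∪ x) = (−1)^g ε̂ · F(θ) ⋆ F(x)`), §1 (`F(θ) = (−1)^g d₁d_g · c_{L_δ}`) and `Λ_{E_δ}(y) = −ε̂·(c_{L_δ} ⋆ y)` (Voisin's `Λ`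
is Künnemann's `f`, for the polarisation `E_δ` of type `δ̂` of `X̂`). The factor `d₁d_g` is the exponent of `φ_L`
(`E_δ = d₁d_g·E^*`; `Λ_{cη} = c⁻¹Λ_η`). [cite: Polishchuk2007FourierStable, §1 (p. 3, display after (1.1))]
[cite: Lange2023AbelianVarietiesComplex, §6.2.3 Prop. 6.2.18 (b) (p. 308); §6.3.2 (pp. 315–316); §2.5.1 Prop. 2.5.1]
[cite: Voisin2002, §6.2.1 Lemma 6.19] -/
theorem IsPolarizationType.coe_fourierForms_cupProduct_ratClass (hd : IsPolarizationType Φ η d) (hη : IsRiemannForm Φ η)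
    {b m : ℕ} (eₐ : Fin (2 + 2 * (j + 1)) ≃ ι) (e_b : Fin (b + (m + 2)) ≃ ι)
    (Ê₂ : Fin ((2 * (j + 1) + (m + 2)) + (2 + b)) ≃ ι ⊕ ι) (ê : Fin (m + (2 + b)) ≃ ι) (e_F : Fin ((2 + b) + m) ≃ ι)
    (x : rationalForms Φ b) :
    (fourierForms Φ e_F (cupProduct Φ rfl (hη.isNSForm.ratClass Φ) x) : (E →L⋆[ℂ] ℂ) [⋀^Fin m]→L[ℝ] ℂ) =
      -(((d 0 * d (Fin.last (j + 1)) : ℕ) : ℂ)) •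
        lefschetzDual (((d 0 * d (Fin.last (j + 1)) : ℕ) : ℝ) • dualForm Φ hη.1 hη.nondegenerate) m
          (fourierForms Φ e_b x : (E →L⋆[ℂ] ℂ) [⋀^Fin (m + 2)]→L[ℝ] ℂ) := by
  have hfr : finrank ℂ E = (j + 1) + 1 :=
    finrank_eq_add_of_equiv Φ ((finCongr (show 2 * 1 + 2 * (j + 1) = 2 + 2 * (j + 1) by omega)).trans eₐ)
  have hsgn : (-1 : ℂ) ^ ((j + 1) + 1) * (-1) ^ j = 1 := by
    rw [← pow_add, show (j + 1) + 1 + j = 2 * (j + 1) by ring, pow_mul, neg_one_sq, one_pow]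
  -- Prop. 6.2.18 (b): `F(θ ∪ x) = (−1)^g ε̂ · F(θ) ⋆ F(x)`, with `F(θ) = (−1)^g d₁d_g · c_{L_δ}`
  have hA := fourierForms_cupProduct_eq_sign_smul Φ eₐ e_b Ê₂ ê e_F (hη.isNSForm.ratClass Φ) x
  rw [hd.fourierForms_ratClass_eq_smul_dualCurveClass Φ hη eₐ, LinearMap.map_smul₂, smul_smul] at hA
  have hA' := congrArg Subtype.val hA
  rw [Submodule.coe_smul, ← Rat.cast_smul_eq_qsmul ℂ] at hA'
  -- `Λ_{E_δ}(F x) = −ε̂ · (c_{L_δ} ⋆ F x)` on `X̂`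
  have hB := (hd.dual Φ hη).coe_lefschetzDual_eq_neg_sign_smul_pontryaginForms_curveClass (dualPeriod Φ)
    (hη.dualPolarization Φ hd) Ê₂ ê (fourierForms Φ e_b x)
  rw [hA', hB, smul_neg, smul_smul, ← neg_smul]
  congr 1
  push_cast
  rw [hfr]
  linear_combination ((orientationSign (prodPeriod (dualPeriod Φ) (dualPeriod Φ)) Ê₂ : ℂ) *
    (orientationSign (dualPeriod Φ) ê : ℂ) * ((d 0 : ℂ) * (d (Fin.last (j + 1)) : ℂ))) * hsgn

end LefschetzE

/-! ## §3 `F(c_L ⋆ y) = ±E^* ∧ F(y)` and `F(Λ_ω x) = E^* ∧ F(x)` for every lattice basis — "`F f F⁻¹ = −e`" -/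

section LefschetzF

variable {ι : Type*} [Fintype ι] [LinearOrder ι] {E : Type uE} [NormedAddCommGroup E] [NormedSpace ℂ E]
  (Φ : (ι → ℝ) ≃L[ℝ] E) {j : ℕ} {η : E [⋀^Fin 2]→L[ℝ] ℝ} {d : Fin (j + 2) → ℕ}

/-- **`F(c_L ⋆ y) = ±E^* ∧ F(y)` for every polarised complex torus, every lattice basis and all frames** (sign `sign(E₂) sign(e′)` of
the frames of `⋆`): Prop. 6.2.18 (a) `F(x ⋆ y) = ± F(x) ∪ F(y)` with `F(c_L) = E^*` (`IsPolarizationType.fourierForm_curveClass`). The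
symplectic-basis case is `IsSymplecticEnum.fourierForm_pontryaginForms_curveClass`.
[cite: Lange2023AbelianVarietiesComplex, §6.2.3 Prop. 6.2.18 (a) (p. 308); §6.3.2 (6.12) and proof of Thm. 6.3.6 (p. 316)]
[cite: Beauville1983FourierChow, Prop. 3 (ii) (p. 243); §3 Prop. 5 (p. 248)] -/
theorem IsPolarizationType.fourierForm_pontryaginForms_curveClass (hd : IsPolarizationType Φ η d) (hη : IsRiemannForm Φ η)
    (e : Fin (2 * (j + 1) + 2) ≃ ι) {b m_b k' : ℕ} (e_b : Fin (b + m_b) ≃ ι)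
    (E₂ : Fin ((2 * (j + 1) + b) + (2 + m_b)) ≃ ι ⊕ ι) (e' : Fin (k' + (2 + m_b)) ≃ ι) (y : rationalForms Φ b) :
    fourierForm Φ e' rfl (pontryaginForms Φ E₂ e' rfl rfl (hη.isNSForm.curveClass Φ (∏ i, d i) (j + 1)) y :
        E [⋀^Fin k']→L[ℝ] ℂ) =
      ((orientationSign (prodPeriod Φ Φ) E₂ * orientationSign Φ e' : ℤ) : ℂ) •
        (ofRealForm (dualForm Φ hη.1 hη.nondegenerate)).wedge (fourierForm Φ e_b rfl y) := by
  have key := congrArg Subtype.val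
    (fourierForms_pontryaginForms_eq_sign_smul Φ e e_b E₂ e' (hη.isNSForm.curveClass Φ (∏ i, d i) (j + 1)) y)
  rw [coe_fourierForms_apply, Submodule.coe_smul, ← Rat.cast_smul_eq_qsmul ℂ, Rat.cast_intCast,
    coe_cupProduct_rfl, coe_fourierForms_apply, coe_fourierForms_apply, hd.fourierForm_curveClass Φ hη e] at key
  exact key

variable [FiniteDimensional ℂ E]

/-- **`F(Λ_ω x) = E^* ∧ F(x)` for EVERY polarised complex torus and EVERY lattice basis** (`ω = c₁(L) = −E` the Kähler sign, `E^*`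
Lang's transport of `E` to `X̂`, `x ∈ H^{m+2}(X, ℚ)`, `e₂`, `e` any enumerations of a lattice basis): the Fourier transform
intertwines the dual Lefschetz operator of `(X, ω)` with the Lefschetz operator `L_{E^*}` of `X̂` — Polishchuk's "`F_d f F_d⁻¹ = −e`"
read for `f = Λ_ω`, through `Λ_ω = ε·(c_L ⋆ ·)` (`Λ_{−η} = −Λ_η` and the any-basis `Λ_η = −ε·(c_L ⋆ ·)`) and `F(c_L ⋆ x) = ±E^* ∧ F(x)`;
the two orientation characters cancel. The symplectic-basis case is `IsSymplecticEnum.fourierForm_lefschetzDual_neg`.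
[cite: Polishchuk2007FourierStable, §1 (p. 3, display after (1.1))] [cite: Voisin2002, §6.2.1 Lemma 6.19]
[cite: Lange2023AbelianVarietiesComplex, §6.2.3 Prop. 6.2.18 (a) and §6.3.2 p. 316] -/
theorem IsPolarizationType.fourierForm_lefschetzDual_neg (hd : IsPolarizationType Φ η d) (hη : IsRiemannForm Φ η)
    {k m : ℕ} (e₂ : Fin ((m + 2) + k) ≃ ι) (e : Fin (m + (2 + k)) ≃ ι) (x : rationalForms Φ (m + 2)) :
    fourierForm Φ e rfl (lefschetzDual (-η) m x) =
      (ofRealForm (dualForm Φ hη.1 hη.nondegenerate)).wedge (fourierForm Φ e₂ rfl (x : E [⋀^Fin (m + 2)]→L[ℝ] ℂ)) := by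
  have hnd : ∀ v : E, v ≠ 0 → ∃ w : E, η ![v, w] ≠ 0 := fun v hv ↦ hη.exists_apply_ne_zero Φ v hv
  have hcard : Fintype.card ι = 2 * (j + 2) := hd.card_eq
  have hN : 2 * (j + 1) + 2 = m + (2 + k) := by
    have h1 := Fintype.card_congr e
    simp only [Fintype.card_fin] at h1
    omega
  -- frames: any `E₂` of `Λ ⊕ Λ` (the signs cancel)
  let E₂ : Fin ((2 * (j + 1) + (m + 2)) + (2 + k)) ≃ ι ⊕ ι :=
    (Fintype.equivFinOfCardEq (by rw [Fintype.card_sum]; omega)).symm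
  rw [lefschetzDual_neg hnd, LinearMap.neg_apply,
    hd.coe_lefschetzDual_eq_neg_sign_smul_pontryaginForms_curveClass Φ hη E₂ e x, neg_neg, fourierForm_smul,
    hd.fourierForm_pontryaginForms_curveClass Φ hη ((finCongr hN).trans e) e₂ E₂ e x, smul_smul, ← Int.cast_mul,
    mul_mul_mul_comm, orientationSign_mul_self, orientationSign_mul_self, mul_one, Int.cast_one, one_smul]

/-- **`F(Λ_η x) = −E^* ∧ F(x)`** (the same with Voisin's sign `Λ_η = −Λ_ω` for the Riemann form `η = E = −c₁(L)` itself).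
[cite: Polishchuk2007FourierStable, §1 (p. 3)] [cite: Voisin2002, §6.2.1 Lemma 6.19] -/
theorem IsPolarizationType.fourierForm_lefschetzDual (hd : IsPolarizationType Φ η d) (hη : IsRiemannForm Φ η)
    {k m : ℕ} (e₂ : Fin ((m + 2) + k) ≃ ι) (e : Fin (m + (2 + k)) ≃ ι) (x : rationalForms Φ (m + 2)) :
    fourierForm Φ e rfl (lefschetzDual η m x) =
      -(ofRealForm (dualForm Φ hη.1 hη.nondegenerate)).wedge (fourierForm Φ e₂ rfl (x : E [⋀^Fin (m + 2)]→L[ℝ] ℂ)) := by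
  have hnd : ∀ v : E, v ≠ 0 → ∃ w : E, η ![v, w] ≠ 0 := fun v hv ↦ hη.exists_apply_ne_zero Φ v hv
  have h1 : lefschetzDual η m x = -lefschetzDual (-η) m x := by
    rw [lefschetzDual_neg hnd, LinearMap.neg_apply, neg_neg]
  rw [h1, fourierForm_neg, hd.fourierForm_lefschetzDual_neg Φ hη e₂ e x]

end LefschetzF

/-! ## §4 `F` carries `ker(θ ∪ ·)` onto the `E_δ`-primitive classes of `X̂`, and `ker Λ_η` onto `ker(E^* ∧ ·)` -/

section Primitive

variable {ι : Type*} [Fintype ι] [LinearOrder ι] {E : Type uE} [NormedAddCommGroup E] [NormedSpace ℂ E]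
  (Φ : (ι → ℝ) ≃L[ℝ] E) {j : ℕ} {η : E [⋀^Fin 2]→L[ℝ] ℝ} {d : Fin (j + 2) → ℕ}

/-- **`θ ∪ x = 0 ↔ F(x)` is `E_δ`-primitive: THE FOURIER TRANSFORM CARRIES THE KERNEL OF THE LEFSCHETZ OPERATOR `L_θ` OF `X` ONTO THE
PRIMITIVE COHOMOLOGY OF THE DUAL POLARISED TORUS `(X̂, E_δ)`.** For `θ = E` a Riemann form of type `(d₁, …, d_g)`, `x ∈ Hᵇ(X, ℚ)` with
`F(x) ∈ H^{m+2}(X̂, ℚ)`, `m + 2 ≤ g`: `θ ∪ x = 0` in `H^{b+2}(X, ℚ)` iff `F(x) ∈ P^{m+2}(X̂, E_δ) = ker(E_δ^{∧(g−m−1)} ∧ ·)`. From §2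
(`F(θ ∪ x) = −d₁d_g·Λ_{E_δ}(F x)`), the injectivity of `F` (Prop. 6.2.20) and `P = ker Λ` in degrees `≤ g` (Lemma 6.24).
[cite: Polishchuk2007FourierStable, §1 (p. 3)] [cite: Voisin2002, §6.2.2 Lemma 6.24]
[cite: Lange2023AbelianVarietiesComplex, §6.2.4 Prop. 6.2.20 (p. 310); §6.2.3 Prop. 6.2.18 (b) (p. 308)] -/
theorem IsPolarizationType.cupProduct_ratClass_eq_zero_iff_fourierForms_mem_primitiveForms
    [FiniteDimensional ℂ (E →L⋆[ℂ] ℂ)] (hd : IsPolarizationType Φ η d) (hη : IsRiemannForm Φ η) {b m : ℕ} (hm : m ≤ j)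
    (e_b : Fin (b + (m + 2)) ≃ ι) (x : rationalForms Φ b) :
    cupProduct Φ rfl (hη.isNSForm.ratClass Φ) x = 0 ↔
      (fourierForms Φ e_b x : (E →L⋆[ℂ] ℂ) [⋀^Fin (m + 2)]→L[ℝ] ℂ) ∈
        primitiveForms (((d 0 * d (Fin.last (j + 1)) : ℕ) : ℝ) • dualForm Φ hη.1 hη.nondegenerate) (m + 2) := by
  have hcard : Fintype.card ι = 2 * (j + 2) := hd.card_eq
  have hb : b + (m + 2) = 2 * (j + 2) := by
    have h1 := Fintype.card_congr e_b
    simp only [Fintype.card_fin] at h1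
    omega
  -- auxiliary frames (the statement does not depend on them)
  let eₐ : Fin (2 + 2 * (j + 1)) ≃ ι := (Fintype.equivFinOfCardEq (by omega)).symm
  let Ê₂ : Fin ((2 * (j + 1) + (m + 2)) + (2 + b)) ≃ ι ⊕ ι :=
    (Fintype.equivFinOfCardEq (by rw [Fintype.card_sum]; omega)).symm
  let ê : Fin (m + (2 + b)) ≃ ι := (Fintype.equivFinOfCardEq (by omega)).symm
  let e_F : Fin ((2 + b) + m) ≃ ι := (Fintype.equivFinOfCardEq (by omega)).symm
  have hpos : ∀ i, 0 < d i := fun i ↦ hd.pos hη i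
  have hDne : (((d 0 * d (Fin.last (j + 1)) : ℕ) : ℂ)) ≠ 0 := by
    exact_mod_cast (Nat.mul_pos (hpos _) (hpos _)).ne'
  have hfr : finrank ℂ (E →L⋆[ℂ] ℂ) = (j + 1) + 1 := by
    rw [finrank_antidual Φ]
    exact finrank_eq_add_of_equiv Φ ((finCongr (show 2 * 1 + 2 * (j + 1) = 2 + 2 * (j + 1) by omega)).trans eₐ)
  rw [← (fourierForms_injective Φ e_F).eq_iff, map_zero, Subtype.ext_iff, Submodule.coe_zero,
    hd.coe_fourierForms_cupProduct_ratClass Φ hη eₐ e_b Ê₂ ê e_F x, neg_smul, neg_eq_zero, smul_eq_zero,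
    or_iff_right hDne, mem_primitiveForms_iff_lefschetzDual_eq_zero
      (fun v hv ↦ (hη.dualPolarization Φ hd).exists_apply_ne_zero (dualPeriod Φ) v hv) (by omega)]

/-- **`Λ_η x = 0 ↔ E^* ∧ F(x) = 0`**: the Fourier transform carries the kernel of Voisin's dual Lefschetz operator `Λ_η` of `X`
(`x ∈ H^{m+2}(X, ℚ)`) onto the kernel of the Lefschetz operator `L_{E^*}` of `X̂` (§3 and the injectivity of `F`).
[cite: Polishchuk2007FourierStable, §1 (p. 3)] [cite: Lange2023AbelianVarietiesComplex, §6.2.4 Prop. 6.2.20 (p. 310)] -/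
theorem IsPolarizationType.lefschetzDual_eq_zero_iff_dualForm_wedge_fourierForm [FiniteDimensional ℂ E]
    (hd : IsPolarizationType Φ η d) (hη : IsRiemannForm Φ η) {k m : ℕ} (e₂ : Fin ((m + 2) + k) ≃ ι)
    (e : Fin (m + (2 + k)) ≃ ι) (x : rationalForms Φ (m + 2)) :
    lefschetzDual η m x = 0 ↔
      (ofRealForm (dualForm Φ hη.1 hη.nondegenerate)).wedge (fourierForm Φ e₂ rfl (x : E [⋀^Fin (m + 2)]→L[ℝ] ℂ)) = 0 := by
  rw [← (fourierForm_injective Φ e).eq_iff, fourierForm_zero, hd.fourierForm_lefschetzDual Φ hη e₂ e x, neg_eq_zero]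

end Primitive

end Literature.Geometry.Kaehler.ComplexTorus

end
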